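import Summits.Ventures.LatticeQCDFlow.Scaling.SingleSiteCollectorLaw

/-!
HONEST FRAMING: exact (Metropolis-corrected) sampling algorithms for lattice gauge theory; figures
of merit are autocorrelation/cost numbers at stated couplings and volumes; no continuum-physics
claim.

# ProductChainCollectorLaw — THE UPDATE SCHEDULE ALONE: FOR EVERY PRODUCT CHAIN `Σ_k w_k·P̃_k` ON `L → S` (ONE
# COORDINATE UPDATED PER STEP, ANY WEIGHTS, ANY `μ_k`-REVERSIBLE COORDINATE KERNELS) FROM A CONFIGURATION WITH
# `Σ_k μ_k(x_k) ≤ δ`: `t_mix(ε) ≥ (|L| − 1)·log(|L|·η)` WHENEVER `ε < 1 − η − δ`; `t_mix(1/4) ≥ (|L| − 1)·log(|L|/4)`,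
# WITH SUCH STARTS AS SOON AS `|S| ≥ 4|L|` (lean-2 GEN-24, ours)

Venture-side (OURS).  Cell `lqcd-flow` (pub-lqcd), unit `pub-lqcd-lean-2-g24`, 2026-08-27.  Chapter L (the coupon-collector
law from a cold start), file 8 (lands after file 9, on which it builds): the swap-free end of the chapter.  The PRODUCT CHAIN `prodKernel w M` of
`Literature/…/ProductChains` (Levin–Peres–Wilmer eq. (12.22): choose coordinate `k` with probability `w_k`, move it by
`M_k`) on `L → S` is the mixture of local moves with `ι = L`, `c = w`, `τ k = {k}`; EVERY set of coordinates is
independent for it and the touch rate of `k` is `w_k`, so the touch sum over all of `L` has `Θ = Σ w = 1` and the average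
form of the collector bound (`Scaling/LazyCollectorFloor`) gives the `|L|·log|L|` law with no condition on the weights.
This is the `t = 0` edge of the exchange schemes of this chapter (no swaps: every replica must be UPDATED once) and the
large-alphabet counterpart of Levin–Peres–Wilmer's Proposition 7.14 (there `S = {0,1}`, where initial values are not
rare and the true order is `½·n·log n`).

## What is proved

* §1 `prodChain_eq_mixture`, `prodChain_kernels_local`, `prodChain_kernels_isRowStochastic` — the product chain is a
  random-scan single-site dynamics in the sense of `Scaling/SingleSiteCollectorLaw` (`d` coordinates `Fin d`).
* §2 `tensorFun_mass_someKept_le_fin` (`π̃{∃ k ∈ T, z_k = x_k} ≤ Σ_{k∈T} μ_k(x_k)`); **`prodChain_worstTvDist_ge`** —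
  `d(n) ≥ 1 − 1/Σ_{k∈T}(1−w_k)ⁿ − Σ_{k∈T} μ_k(x_k)` for every `T`, `x`, `n`; **`prodChain_mixingTime_ge` (THE
  UPDATE-SCHEDULE COLLECTOR LAW)** — `d ≥ 2`, `w` a probability vector, `μ_k`-reversible `M_k`, `Σ_k μ_k(x_k) ≤ δ`,
  `0 < η`, `ε < 1 − η − δ`, the chain `ε`-close to `π̃` at some time: **`t_mix(ε) ≥ (d − 1)·log(d·η)`**;
  `prodChain_mixingTime_ge_quarter`; `exists_rare_start_fin`, `prodChain_mixingTime_ge_of_card` (`|S| ≥ 4d`).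

Reading (no numerics implied): however the update budget is allocated over the coordinates, a one-coordinate-per-step
sampler on a large alphabet cannot mix before the allocation has visited every coordinate, `|L|·log|L|` steps; uneven
weights only make it worse (Jensen).  NOT CLAIMED: small alphabets (`|S| < 4|L|`, where the `½` of the hypercube
appears); block updates; continuous spaces.  Literature grade (cell rule): KNOWN MECHANISM (coupon collector /
LPW Prop. 7.14), NEW TYPING for arbitrary weights and kernels; nothing cited as a fact; no new bib keys.
-/

noncomputable section

open Finset Function
open Literature.Probability.MarkovChains

namespace Summit.Ventures.LatticeQCDFlow.Scaling

variable {S : Type*} [Fintype S] [DecidableEq S] {d : ℕ} {μ : Fin d → S → ℝ} {M : Fin d → S → S → ℝ}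
  {w : Fin d → ℝ}

/-! ## §1 The product chain as a random-scan single-site dynamics -/

omit [Fintype S] in
/-- `prodKernel w M (y,z) = Σ_k w_k·coordKernel M k (y,z)` — the mixture presentation. [ours] -/
theorem prodChain_eq_mixture (y z : Fin d → S) : prodKernel w M y z = ∑ k, w k * coordKernel M k y z :=
  prodKernel_apply M w y z

omit [Fintype S] in
/-- The coordinate kernels are local: `coordKernel M j (y,z) ≠ 0`, `k ≠ j` ⇒ `z_k = y_k`. [ours] -/
theorem prodChain_kernels_local :
    ∀ (j : Fin d) (y z : Fin d → S) (k : Fin d), k ≠ j → coordKernel M j y z ≠ 0 → z k = y k := by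
  intro j y z k hk h
  unfold coordKernel at h
  by_cases hz : z = update y j (z j)
  · have := congrFun hz k
    rw [update_of_ne hk] at this
    exact this
  · exact absurd (if_neg hz) h

/-- The coordinate kernels are transition matrices (`M_k` row-stochastic). [ours] -/
theorem prodChain_kernels_isRowStochastic (hM : ∀ k, IsRowStochastic (M k)) :
    ∀ j : Fin d, IsRowStochastic (coordKernel M j) := by
  intro j
  refine ⟨fun y z => coordKernel_nonneg M (fun i u v => (hM i).1 u v) j y z, fun y => ?_⟩
  have h := sum_coordKernel_mul M j y (fun _ => (1 : ℝ))
  simp only [mul_one] at h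
  rw [h, (hM j).2]

/-! ## §2 The update-schedule collector law -/

omit [DecidableEq S] in
/-- `π̃{z : ∃ k ∈ T, z_k = x_k} ≤ Σ_{k∈T} μ_k(x_k)` on `Fin d → S` (union bound). [ours] -/
theorem tensorFun_mass_someKept_le_fin [DecidableEq S] (hμ : ∀ k x, 0 < μ k x) (hμ1 : ∀ k, ∑ u, μ k u = 1)
    (x : Fin d → S) (T : Finset (Fin d)) :
    ∑ z ∈ univ.filter (fun z : Fin d → S => ∃ k ∈ T, z k = x k), tensorFun μ z ≤ ∑ k ∈ T, μ k (x k) := by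
  have hπ := tensorFun_pos hμ
  calc ∑ z ∈ univ.filter (fun z : Fin d → S => ∃ k ∈ T, z k = x k), tensorFun μ z
      = ∑ z, tensorFun μ z * (if ∃ k ∈ T, z k = x k then (1 : ℝ) else 0) := by
        rw [Finset.sum_filter]; exact sum_congr rfl fun z _ => by split_ifs <;> simp
    _ ≤ ∑ z, tensorFun μ z * ∑ k ∈ T, (if z k = x k then (1 : ℝ) else 0) := by
        refine sum_le_sum fun z _ => mul_le_mul_of_nonneg_left ?_ (hπ z).le
        split_ifs with h
        · obtain ⟨k, hk, hzk⟩ := h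
          exact le_trans (by rw [if_pos hzk])
            (Finset.single_le_sum (f := fun k => if z k = x k then (1 : ℝ) else 0)
              (fun k _ => by split_ifs <;> norm_num) hk)
        · exact sum_nonneg fun k _ => by split_ifs <;> norm_num
    _ = ∑ k ∈ T, ∑ z, tensorFun μ z * (if z k = x k then (1 : ℝ) else 0) := by
        simp_rw [mul_sum]; rw [sum_comm]
    _ = ∑ k ∈ T, μ k (x k) := by
        refine sum_congr rfl fun k _ => ?_
        have h := sum_tensorFun_mul_apply μ hμ1 k (fun u => if u = x k then (1 : ℝ) else 0)
        simp only [mul_ite, mul_one, mul_zero, Finset.sum_ite_eq' univ, Finset.mem_univ, if_true] at h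
        rw [← h]
        exact sum_congr rfl fun z _ => by split_ifs <;> simp

/-- **`d(n) ≥ 1 − 1/Σ_{k∈T}(1−w_k)ⁿ − Σ_{k∈T} μ_k(x_k)`** for the product chain, every `T`, `x`, `n` (`w ≥ 0`, `Σ w = 1`,
`M_k` row-stochastic, `μ_k` positive probability vectors). [ours] -/
theorem prodChain_worstTvDist_ge (hμ : ∀ k x, 0 < μ k x) (hμ1 : ∀ k, ∑ u, μ k u = 1)
    (hM : ∀ k, IsRowStochastic (M k)) (hw0 : ∀ k, 0 ≤ w k) (hw1 : ∑ k, w k = 1) (x : Fin d → S)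
    (T : Finset (Fin d)) (n : ℕ) (hs : 0 < ∑ k ∈ T, (1 - w k) ^ n) :
    1 - 1 / (∑ k ∈ T, (1 - w k) ^ n) - ∑ k ∈ T, μ k (x k) ≤ worstTvDist (prodKernel w M) (tensorFun μ) n := by
  have hB := tensorFun_mass_someKept_le_fin hμ hμ1 x T
  have h := singleSite_worstTvDist_ge (Ksite := coordKernel M) (P := prodKernel w M) hw0 hw1
    (prodChain_kernels_isRowStochastic hM) prodChain_kernels_local (fun y z => prodChain_eq_mixture (M := M) (w := w) y z)
    (sum_tensorFun_eq_one μ hμ1) x T n hs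
  -- the generic-`L` lemma and the `Fin d` statement may carry different decidability instances on the bad set
  have h' : 1 - 1 / (∑ k ∈ T, (1 - w k) ^ n)
      - ∑ z ∈ univ.filter (fun z : Fin d → S => ∃ k ∈ T, z k = x k), tensorFun μ z
      ≤ worstTvDist (prodKernel w M) (tensorFun μ) n := by
    convert h
  linarith

/-- **THE UPDATE-SCHEDULE COLLECTOR LAW:** `d ≥ 2` coordinates, `w` a probability vector, `μ_k`-reversible
row-stochastic `M_k`, a configuration `x` with `Σ_k μ_k(x_k) ≤ δ`, `0 < η`, `ε < 1 − η − δ`, the product chain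
`ε`-close to `π̃` at some time: **`t_mix(ε) ≥ (d − 1)·log(d·η)`**. [ours] -/
theorem prodChain_mixingTime_ge (hd : 2 ≤ d) (hμ : ∀ k x, 0 < μ k x) (hμ1 : ∀ k, ∑ u, μ k u = 1)
    (hM : ∀ k, IsRowStochastic (M k)) (hMrev : ∀ k, DetailedBalance (μ k) (M k)) (hw0 : ∀ k, 0 ≤ w k)
    (hw1 : ∑ k, w k = 1) (x : Fin d → S) {η δ ε : ℝ} (hη : 0 < η) (hδ : ∑ k, μ k (x k) ≤ δ)
    (hgap : ε < 1 - η - δ) (hmix : ∃ t₀, worstTvDist (prodKernel w M) (tensorFun μ) t₀ ≤ ε) :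
    ((d : ℝ) - 1) * Real.log (d * η) ≤ (mixingTime (prodKernel w M) (tensorFun μ) ε : ℝ) := by
  have hP := prodKernel_isRowStochastic M w hw0 hw1 hM
  have hst := (prodKernel_detailedBalance (π := μ) hMrev w).isStationary hP.2
  have hB := tensorFun_mass_someKept_le_fin hμ hμ1 x (univ : Finset (Fin d))
  have h := singleSite_mixingTime_ge (Ksite := coordKernel M) (P := prodKernel w M) (by rwa [Fintype.card_fin]) hw0 hw1
    (prodChain_kernels_isRowStochastic hM) prodChain_kernels_local (fun y z => prodChain_eq_mixture (M := M) (w := w) y z)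
    (sum_tensorFun_eq_one μ hμ1) hst x hη (by convert hB.trans hδ using 3; rfl) hgap hmix
  rwa [Fintype.card_fin] at h

/-- **THE QUARTER LAW: `t_mix(1/4) ≥ (d − 1)·log(d/4)`** from a start with `Σ_k μ_k(x_k) ≤ 1/4`. [ours] -/
theorem prodChain_mixingTime_ge_quarter (hd : 2 ≤ d) (hμ : ∀ k x, 0 < μ k x) (hμ1 : ∀ k, ∑ u, μ k u = 1)
    (hM : ∀ k, IsRowStochastic (M k)) (hMrev : ∀ k, DetailedBalance (μ k) (M k)) (hw0 : ∀ k, 0 ≤ w k)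
    (hw1 : ∑ k, w k = 1) (x : Fin d → S) (hx : ∑ k, μ k (x k) ≤ 1 / 4)
    (hmix : ∃ t₀, worstTvDist (prodKernel w M) (tensorFun μ) t₀ ≤ 1 / 4) :
    ((d : ℝ) - 1) * Real.log (d / 4) ≤ (mixingTime (prodKernel w M) (tensorFun μ) (1 / 4) : ℝ) := by
  have h := prodChain_mixingTime_ge hd hμ hμ1 hM hMrev hw0 hw1 x (η := 1 / 4) (by norm_num) hx
    (by norm_num : (1 : ℝ) / 4 < 1 - 1 / 4 - 1 / 4) hmix
  rwa [mul_one_div] at h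

omit [DecidableEq S] in
/-- Rare starts exist on a large alphabet: `4d ≤ |S|` ⇒ some `x` has `Σ_k μ_k(x_k) ≤ 1/4`. [ours] -/
theorem exists_rare_start_fin (hμ1 : ∀ k, ∑ u, μ k u = 1) (hS : 4 * d ≤ Fintype.card S) :
    ∃ x : Fin d → S, ∑ k, μ k (x k) ≤ 1 / 4 := by
  choose u hu using fun k => exists_apply_le_inv_card (hμ1 k)
  refine ⟨u, ?_⟩
  rcases Nat.eq_zero_or_pos d with hd0 | hdpos
  · subst hd0; simp
  · have hcard : (0 : ℝ) < Fintype.card S := by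
      have : 0 < Fintype.card S := by omega
      exact_mod_cast this
    have hS' : (4 : ℝ) * d ≤ Fintype.card S := by exact_mod_cast hS
    calc ∑ k, μ k (u k) ≤ ∑ _k : Fin d, (1 : ℝ) / Fintype.card S := sum_le_sum fun k _ => hu k
      _ = (d : ℝ) / Fintype.card S := by rw [sum_const, card_univ, Fintype.card_fin, nsmul_eq_mul]; field_simp
      _ ≤ 1 / 4 := by rw [div_le_iff₀ hcard]; linarith

/-- **THE QUARTER LAW ON A LARGE ALPHABET (`|S| ≥ 4d`, `d ≥ 2`): `t_mix(1/4) ≥ (d − 1)·log(d/4)`** for every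
weights and reversible coordinate kernels, the product chain `1/4`-close at some time. [ours] -/
theorem prodChain_mixingTime_ge_of_card (hd : 2 ≤ d) (hS : 4 * d ≤ Fintype.card S) (hμ : ∀ k x, 0 < μ k x)
    (hμ1 : ∀ k, ∑ u, μ k u = 1) (hM : ∀ k, IsRowStochastic (M k)) (hMrev : ∀ k, DetailedBalance (μ k) (M k))
    (hw0 : ∀ k, 0 ≤ w k) (hw1 : ∑ k, w k = 1) (hmix : ∃ t₀, worstTvDist (prodKernel w M) (tensorFun μ) t₀ ≤ 1 / 4) :
    ((d : ℝ) - 1) * Real.log (d / 4) ≤ (mixingTime (prodKernel w M) (tensorFun μ) (1 / 4) : ℝ) := by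
  obtain ⟨x, hx⟩ := exists_rare_start_fin (μ := μ) hμ1 hS
  exact prodChain_mixingTime_ge_quarter hd hμ hμ1 hM hMrev hw0 hw1 x hx hmix

end Summit.Ventures.LatticeQCDFlow.Scaling

end
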